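import Summits.ResolutionOfSingularities.ResolutionOfSingularities.Theorems.HomologicalConductorNoZenoUpstairsGermCount
import Summits.ResolutionOfSingularities.ResolutionOfSingularities.Theorems.HomologicalConductorNoZenoSplitChartAssemblyOver
import Summits.ResolutionOfSingularities.ResolutionOfSingularities.Theorems.HomologicalConductorNoZenoSplitCountDescentChartGerm
import Summits.ResolutionOfSingularities.ResolutionOfSingularities.Theorems.HomologicalConductorNoZenoStalkDimTwo
import Summits.ResolutionOfSingularities.ResolutionOfSingularities.Theorems.HomologicalConductorNoZenoSandwichRegularCorner
import Summits.ResolutionOfSingularities.ResolutionOfSingularities.Theorems.HomologicalConductorNoZenoSplitCountInvariance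
import Summits.ResolutionOfSingularities.ResolutionOfSingularities.Theorems.HomologicalConductorNoZenoL1CoreRational
import HarnessLib

/-!
# Crux `NoZenoR` (stmt-ResolutionOfSingularities-19943), slot 5 (B1) `stub_L1wCoreF3`: THE CLOSER CORE (ROUTE M) —
# `Sig.L1Core` from the upstairs sandwich data of ONE splitting polynomial

OURS (cell res-hironaka, crux chain W4.4, lead res-L0-w44-lead-1 g9); nothing here is a statement of the manuscript under review (Hironaka
2017); AI-written, weaker than expert review.  SUPPORT-level, counted 0.  Def-free.  FACTS as explicit binders (BRICK RULE).

`l1wCore_of_sandwichData`: the conclusion of `Beta2Descent.Sig.L1Core HasSplitExcCurveCountLE IsSepX1Sandwiched` for given binders, from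
the UNPACKED habitat (`π` minimal, `ρ` the sep-node blow-up, principality) and, for ONE splitting polynomial `f` over the germ `D = T_P`,
the UPSTAIRS data over `D_f = locPrime (splitModel D f) (splitPrime D f)` (seam-0, res-D-pv-039 `…SandwichBaseChange`): the pulled-back
resolution `π_f` with `N^s(π_f) ≤ N` and split weights one, the pulled-back blow-up `ρ_f` of the finite centre `σ⁻¹(sepNodes π)`, two
distinct curves of `π_f` through each centre point, and principality of `(C)·𝒪` upstairs.  PROOF (Route M): `1 ≤ N` (p562466); `D′`
rational (p535916) so the regular case is the left disjunct; pick ONE chart prime `𝔮f` over `𝔮` (`exists_chartPrime_over`) and the upstairs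
chart binders keyed to it (`exists_upstairs_binders_over`, p574918); seam-1∘seam-2 upstairs (`hasSplitExcCurveCountLE_pred_of_finiteCentre`,
p576042) gives `N^s((nrm B_f)_{𝔮′}) ≤ N − 1`; the tie moves it to `(k[nrm B ∪ {β}])_{𝔮f}`; seam-3 (`hasSplitExcCurveCountLE_chartGerm'`,
o5 p576146 on pv-039 p573864 / stub-2 p568188) descends it to `D′ = (nrm B)_𝔮`.

References: J. Lipman, *Rational singularities …*, Publ. Math. IHÉS 36 (1969) [`Lipman1969`].
-/

noncomputable section

-- single-problem summit: the doubled namespace component `ResolutionOfSingularities` is forced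
set_option linter.dupNamespace false

open CategoryTheory CategoryTheory.Limits AlgebraicGeometry TopologicalSpace Opposite IsLocalRing Polynomial
open Literature.AlgebraicGeometry Literature.AlgebraicGeometry.Resolution Literature.AlgebraicGeometry.Motives
open Summit.ResolutionOfSingularities.ResolutionOfSingularities.Theorems.NoZeno.Birth (nrm nrm_eq_nrm)
open Summit.ResolutionOfSingularities.ResolutionOfSingularities.Theorems.NoZeno.SandwichCluster
open Summit.ResolutionOfSingularities.ResolutionOfSingularities.Theorems.NoZeno.SandwichCluster.Parasite
  (locPrime isLocalRing_locPrime mem_locPrime_of_mem)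
open Summit.ResolutionOfSingularities.ResolutionOfSingularities.Theorems.NoZeno.SandwichCluster.Thread
  (toSubring_le_locPrime isLocalization_locPrime essFiniteType_blowupChart)
open Summit.ResolutionOfSingularities.ResolutionOfSingularities.Theorems.NoZeno.SplittingBase
open Summit.ResolutionOfSingularities.ResolutionOfSingularities.Theorems.SyzygyFlattening
  (self_le_nrm isIntegrallyClosed_nrm stub_essFiniteType_nrm)

namespace Summit.ResolutionOfSingularities.ResolutionOfSingularities.Theorems.NoZeno.ExcCount

variable {k K : Type} [Field k] [Field K] [Algebra k K]

/-- Transport of `HasSplitExcCurveCountLE` along an equality of subrings (the two local-ring instances are propositionally equal).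
[folklore] -/
theorem hasSplitExcCurveCountLE_of_subring_eq {L : Type} [Field L] {A B : Subring L} (h : A = B)
    (hA : IsLocalRing ↥A) (hB : IsLocalRing ↥B) {m : ℕ} (hm : @HasSplitExcCurveCountLE ↥A _ hA m) :
    @HasSplitExcCurveCountLE ↥B _ hB m := by
  subst h
  exact hm

/-- **THE CLOSER CORE (ROUTE M).**  See the module docstring. [cite: Lipman1969, Theorem (4.1) (p. 204), Corollary (27.3) (p. 277)] -/
theorem l1wCore_of_sandwichData
    (h131b : Lipman1969_13_1_b_rat.{0}) (h131d : Lipman1969_13_1_d_rat.{0}) (h15a : Lipman1969_15_a.{0})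
    (h12 : Lipman1969_1_2.{0}) (h41 : Lipman1969_4_1.{0}) (h121i : Lipman1969_12_1_i.{0})
    (h161 : Lipman1969_16_1_ii.{0}) (h165 : Lipman1969_16_5.{0}) (h273 : Lipman1969_27_3_rat.{0})
    -- the `Sig.L1Core` binders
    (T : Subalgebra k K) (P : Ideal ↥T) (hP : P.IsPrime)
    [Algebra.EssFiniteType k ↥T] [IsIntegrallyClosed ↥T] [IsFractionRing ↥T K]
    (hdim : ringKrullDim ↥(locPrime T P hP) = 2) (hrat : HasRationalSingularity ↥(locPrime T P hP))
    (N : ℕ)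
    (C : Set K) (hCT : C ⊆ (T : Set K))
    (hrad : (Ideal.span {d : ↥(locPrime T P hP) | (d : K) ∈ C}).radical =
      @maximalIdeal ↥(locPrime T P hP) _ (isLocalRing_locPrime T P hP))
    (x : K) (hxC : x ∈ C) (hx0 : x ≠ 0)
    (B : Subalgebra k K) (hB : B = Algebra.adjoin k ((locPrime T P hP : Set K) ∪ {y : K | ∃ c ∈ C, y = c * x⁻¹}))
    (𝔮 : Ideal ↥(nrm B)) (h𝔮 : 𝔮.IsPrime) (D' : Subring K) (hD' : IsLocalRing ↥D')
    (hEq : locPrime (nrm B) 𝔮 h𝔮 = D') (hDD' : (locPrime T P hP : Set K) ⊆ D')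
    (hdim' : ringKrullDim ↥D' = 2) (hnorm' : IsIntegrallyClosed ↥D')
    -- the habitat data (downstairs): the resolution `π` and the blow-up `ρ` (their minimality / centre are not used here)
    {X : Scheme.{0}} (π : X ⟶ Spec (.of ↥(locPrime T P hP))) {X1 : Scheme.{0}} (ρ : X1 ⟶ X)
    -- ONE splitting polynomial over `D := locPrimeSubalgebra T P hP` and the UPSTAIRS data (seam 0)
    (f : (↥(locPrimeSubalgebra T P hP))[X]) (hf : f.Monic)
    (hirr : Irreducible (f.map (residue ↥(locPrimeSubalgebra T P hP))))
    (hsep : (f.map (residue ↥(locPrimeSubalgebra T P hP))).Separable)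
    [Fact (Irreducible (f.map (algebraMap ↥(locPrimeSubalgebra T P hP) K)))]
    (hPf : (splitPrime (locPrimeSubalgebra T P hP) f).IsPrime)
    (hπf : IsResolution (pullback.snd π (Spec.map (CommRingCat.ofHom (algebraMap ↥(locPrimeSubalgebra T P hP)
      ↥(locPrime (splitModel (locPrimeSubalgebra T P hP) f) (splitPrime (locPrimeSubalgebra T P hP) f) hPf))))))
    (hNf : splitExcCount (pullback.snd π (Spec.map (CommRingCat.ofHom (algebraMap ↥(locPrimeSubalgebra T P hP)
      ↥(locPrime (splitModel (locPrimeSubalgebra T P hP) f) (splitPrime (locPrimeSubalgebra T P hP) f) hPf))))) ≤ N)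
    (hw1f : ∀ η ∈ excCurvePoints (pullback.snd π (Spec.map (CommRingCat.ofHom (algebraMap ↥(locPrimeSubalgebra T P hP)
      ↥(locPrime (splitModel (locPrimeSubalgebra T P hP) f) (splitPrime (locPrimeSubalgebra T P hP) f) hPf))))),
      splitWeight (pullback.snd π (Spec.map (CommRingCat.ofHom (algebraMap ↥(locPrimeSubalgebra T P hP)
        ↥(locPrime (splitModel (locPrimeSubalgebra T P hP) f) (splitPrime (locPrimeSubalgebra T P hP) f) hPf))))) η = 1)
    (hNcfin : ((pullback.fst π (Spec.map (CommRingCat.ofHom (algebraMap ↥(locPrimeSubalgebra T P hP)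
      ↥(locPrime (splitModel (locPrimeSubalgebra T P hP) f) (splitPrime (locPrimeSubalgebra T P hP) f) hPf))))).base ⁻¹'
        sepNodes π).Finite)
    (hNccl : ∀ z₁ ∈ (pullback.fst π (Spec.map (CommRingCat.ofHom (algebraMap ↥(locPrimeSubalgebra T P hP)
      ↥(locPrime (splitModel (locPrimeSubalgebra T P hP) f) (splitPrime (locPrimeSubalgebra T P hP) f) hPf))))).base ⁻¹'
        sepNodes π, IsClosed ({z₁} : Set _))
    (hρf : IsBlowup (pullback.snd ρ (pullback.fst π (Spec.map (CommRingCat.ofHom (algebraMap ↥(locPrimeSubalgebra T P hP)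
      ↥(locPrime (splitModel (locPrimeSubalgebra T P hP) f) (splitPrime (locPrimeSubalgebra T P hP) f) hPf))))))
      (Scheme.IdealSheafData.vanishingIdeal ⟨(pullback.fst π (Spec.map (CommRingCat.ofHom (algebraMap
        ↥(locPrimeSubalgebra T P hP) ↥(locPrime (splitModel (locPrimeSubalgebra T P hP) f)
          (splitPrime (locPrimeSubalgebra T P hP) f) hPf))))).base ⁻¹' sepNodes π,
        FiniteCentreBlowup.isClosed_of_finite_of_isClosed_singleton hNcfin hNccl⟩))
    (hsplitf : ∀ z₁ ∈ (pullback.fst π (Spec.map (CommRingCat.ofHom (algebraMap ↥(locPrimeSubalgebra T P hP)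
      ↥(locPrime (splitModel (locPrimeSubalgebra T P hP) f) (splitPrime (locPrimeSubalgebra T P hP) f) hPf))))).base ⁻¹'
        sepNodes π, ∃ a b,
        a ∈ excCurvePoints (pullback.snd π (Spec.map (CommRingCat.ofHom (algebraMap ↥(locPrimeSubalgebra T P hP)
          ↥(locPrime (splitModel (locPrimeSubalgebra T P hP) f) (splitPrime (locPrimeSubalgebra T P hP) f) hPf))))) ∧
        b ∈ excCurvePoints (pullback.snd π (Spec.map (CommRingCat.ofHom (algebraMap ↥(locPrimeSubalgebra T P hP)
          ↥(locPrime (splitModel (locPrimeSubalgebra T P hP) f) (splitPrime (locPrimeSubalgebra T P hP) f) hPf))))) ∧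
        a ≠ b ∧ a ⤳ z₁ ∧ b ⤳ z₁)
    (hprinf : ∀ x₁ : ↑(pullback ρ (pullback.fst π (Spec.map (CommRingCat.ofHom (algebraMap ↥(locPrimeSubalgebra T P hP)
      ↥(locPrime (splitModel (locPrimeSubalgebra T P hP) f) (splitPrime (locPrimeSubalgebra T P hP) f) hPf)))))),
      IsLocalHom (toStalk (pullback.snd ρ (pullback.fst π (Spec.map (CommRingCat.ofHom (algebraMap
          ↥(locPrimeSubalgebra T P hP) ↥(locPrime (splitModel (locPrimeSubalgebra T P hP) f)
            (splitPrime (locPrimeSubalgebra T P hP) f) hPf))))) ≫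
        pullback.snd π (Spec.map (CommRingCat.ofHom (algebraMap ↥(locPrimeSubalgebra T P hP)
          ↥(locPrime (splitModel (locPrimeSubalgebra T P hP) f) (splitPrime (locPrimeSubalgebra T P hP) f) hPf))))) x₁) →
      ((Ideal.span {d : ↥(locPrime (splitModel (locPrimeSubalgebra T P hP) f) (splitPrime (locPrimeSubalgebra T P hP) f) hPf) |
          (d : AdjoinRoot (f.map (algebraMap ↥(locPrimeSubalgebra T P hP) K))) ∈
            algebraMap K (AdjoinRoot (f.map (algebraMap ↥(locPrimeSubalgebra T P hP) K))) '' C}).map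
        (toStalk (pullback.snd ρ (pullback.fst π (Spec.map (CommRingCat.ofHom (algebraMap
            ↥(locPrimeSubalgebra T P hP) ↥(locPrime (splitModel (locPrimeSubalgebra T P hP) f)
              (splitPrime (locPrimeSubalgebra T P hP) f) hPf))))) ≫
          pullback.snd π (Spec.map (CommRingCat.ofHom (algebraMap ↥(locPrimeSubalgebra T P hP)
            ↥(locPrime (splitModel (locPrimeSubalgebra T P hP) f) (splitPrime (locPrimeSubalgebra T P hP) f) hPf))))) x₁)).IsPrincipal) :
    IsRegularLocalRing ↥D' ∨ (HasRationalSingularity ↥D' ∧ @HasSplitExcCurveCountLE ↥D' _ hD' (N - 1)) := by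
  subst hEq
  haveI : IsNoetherianRing ↥T := Algebra.EssFiniteType.isNoetherianRing k ↥T
  haveI := isLocalRing_locPrime T P hP
  haveI := hP
  haveI := hD'
  haveI := hnorm'
  -- (R) the new germ is rational; the regular case
  have hratD' : HasRationalSingularity ↥(locPrime (nrm B) 𝔮 h𝔮) :=
    Thread.L1Core_hasRationalSingularity h12 T P hP inferInstance inferInstance inferInstance hdim hrat C hCT x B hB 𝔮 h𝔮 _
      rfl hDD' hdim' hnorm'
  by_cases hregD' : IsRegularLocalRing ↥(locPrime (nrm B) 𝔮 h𝔮)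
  · exact Or.inl hregD'
  refine Or.inr ⟨hratD', ?_⟩
  -- notation for the upstairs germ
  haveI : IsLocalRing ↥(locPrimeSubalgebra T P hP) := isLocalRing_locPrime T P hP
  -- instances on the upstairs model / germ
  haveI : Algebra.EssFiniteType k ↥(splitModel (locPrimeSubalgebra T P hP) f) := essFiniteType_splitModel (locPrimeSubalgebra T P hP) f hf
  haveI : IsIntegrallyClosed ↥(splitModel (locPrimeSubalgebra T P hP) f) := isIntegrallyClosed_splitModel (locPrimeSubalgebra T P hP) f hf hirr hsep
  haveI : IsFractionRing ↥(splitModel (locPrimeSubalgebra T P hP) f) (AdjoinRoot (f.map (algebraMap ↥(locPrimeSubalgebra T P hP) K))) := isFractionRing_splitModel (locPrimeSubalgebra T P hP) f hf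
  haveI := isLocalRing_locPrime (splitModel (locPrimeSubalgebra T P hP) f) (splitPrime (locPrimeSubalgebra T P hP) f) hPf
  haveI := isNoetherianRing_germ (locPrimeSubalgebra T P hP) f hf hirr hPf
  have hdimf : ringKrullDim ↥(locPrime (splitModel (locPrimeSubalgebra T P hP) f) (splitPrime (locPrimeSubalgebra T P hP) f) hPf) = 2 :=
    (ringKrullDim_germ (locPrimeSubalgebra T P hP) f hf hirr hsep hPf).trans hdim
  have hratf : HasRationalSingularity ↥(locPrime (splitModel (locPrimeSubalgebra T P hP) f) (splitPrime (locPrimeSubalgebra T P hP) f) hPf) :=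
    hasRationalSingularity_germ h165 (locPrimeSubalgebra T P hP) f hf hirr hsep hPf hdim hrat
  -- the chart ring `B`, its normalisation `nrm B`, and ONE chart prime `𝔮f` over `𝔮`
  have hDB : (locPrimeSubalgebra T P hP) ≤ B := fun y hy => by rw [hB]; exact Algebra.subset_adjoin (Or.inl hy)
  haveI : IsFractionRing ↥B K := isFractionRing_subalgebra_of_le _ B hDB
  haveI : Algebra.EssFiniteType k ↥B := essFiniteType_blowupChart T P hP C hCT x B hB
  haveI : Algebra.EssFiniteType k ↥(nrm B) := stub_essFiniteType_nrm k K B inferInstance inferInstance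
  haveI : IsNoetherianRing ↥(nrm B) := Algebra.EssFiniteType.isNoetherianRing k _
  haveI : IsIntegrallyClosed ↥(nrm B) := isIntegrallyClosed_nrm B
  haveI : IsFractionRing ↥(nrm B) K := isFractionRing_subalgebra_of_le B _ (self_le_nrm B)
  have hDR : (locPrimeSubalgebra T P hP) ≤ nrm B := hDB.trans (self_le_nrm B)
  obtain ⟨𝔮f, h𝔮f, hover⟩ := exists_chartPrime_over (locPrimeSubalgebra T P hP) (nrm B) hDR f 𝔮 h𝔮 hf
  -- the upstairs chart binders keyed to `𝔮f`
  obtain ⟨𝔮', h𝔮', htie, hCf, hradf, hxCf, hx0f, hsubf, hdimf', hICf, hregf, hratf'⟩ :=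
    exists_upstairs_binders_over T P hP f hf hirr hsep hPf C hCT hrad x hxC hx0 B hB 𝔮 h𝔮 _ hD' rfl hdim' hnorm' 𝔮f h𝔮f hover
  haveI := isLocalRing_locPrime _ 𝔮' h𝔮'
  have hsingf : ¬ IsRegularLocalRing ↥(locPrime _ 𝔮' h𝔮') := fun h => hregD' (hregf.mp h)
  have hratDf' := hratf' h165 hratD'
  -- the downstairs count on the minimal resolution
  -- the centre points have two-dimensional local rings
  have hNdim : ∀ z₁ ∈ (pullback.fst π (Spec.map (CommRingCat.ofHom (algebraMap ↥(locPrimeSubalgebra T P hP)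
      ↥(locPrime (splitModel (locPrimeSubalgebra T P hP) f) (splitPrime (locPrimeSubalgebra T P hP) f) hPf))))).base ⁻¹' sepNodes π,
      ringKrullDim ((pullback π (Spec.map (CommRingCat.ofHom (algebraMap ↥(locPrimeSubalgebra T P hP)
        ↥(locPrime (splitModel (locPrimeSubalgebra T P hP) f) (splitPrime (locPrimeSubalgebra T P hP) f) hPf))))).presheaf.stalk z₁) = 2 := by
    intro z₁ hz₁
    obtain ⟨a, -, ha, -, -, haz, -⟩ := hsplitf z₁ hz₁
    refine ringKrullDim_stalk_eq_two_of_specializes hdimf _ hπf ⟨a, ha, haz, fun h => ?_⟩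
    have h0 := Scheme.height_of_isClosed (hNccl z₁ hz₁)
    rw [h, ha.2] at h0
    exact one_ne_zero h0
  -- seam 1 ∘ seam 2 UPSTAIRS
  have hcount := hasSplitExcCurveCountLE_pred_of_finiteCentre h273 h131d h131b h15a h41 h12 h121i
    (splitModel (locPrimeSubalgebra T P hP) f) (splitPrime (locPrimeSubalgebra T P hP) f) hPf hdimf hratf _ hCf hradf _ hxCf hx0f _ rfl 𝔮' h𝔮' _
    (isLocalRing_locPrime _ 𝔮' h𝔮') rfl hsubf hdimf' hICf hratDf' hsingf _ hπf hNf hw1f hNcfin hNccl hNdim hsplitf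
    _ hρf hprinf
  -- the tie: move the count to the `𝔮f`-germ
  have hL : locPrime _ 𝔮' h𝔮' = locPrime (adjoinBeta (nrm B) (f.map (algebraMap ↥(locPrimeSubalgebra T P hP) K))) 𝔮f h𝔮f :=
    SetLike.ext htie
  have hcount' := hasSplitExcCurveCountLE_of_subring_eq hL (isLocalRing_locPrime _ 𝔮' h𝔮')
    (isLocalRing_locPrime _ 𝔮f h𝔮f) hcount
  -- seam 3: descend along `(locPrimeSubalgebra T P hP)′ → (locPrimeSubalgebra T P hP)′_f`
  exact hasSplitExcCurveCountLE_chartGerm' h41 h161 h165 h273 h131b h131d (locPrimeSubalgebra T P hP) (nrm B) hDR f 𝔮 h𝔮 hf hsep 𝔮f h𝔮f hover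
    hdim' hratD' hcount'

end Summit.ResolutionOfSingularities.ResolutionOfSingularities.Theorems.NoZeno.ExcCount

end
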